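import Literature.NumberTheory.IwasawaTheory.Fukuda1994Thm1RankLayer
import Literature.NumberTheory.NumberFields.UnramifiedElementaryCoinvariantModP
import Literature.NumberTheory.NumberFields.PureCubicClassNumberModThreeProofs
import HarnessLib

/-!
# Fukuda 1994, Theorem 1 (2) at finite level — the PER-LAYER export of the COINVARIANT quotient: for `K_n ⊆ K_{n+i} ⊆ K_{n+j} ⊆ K_{n+t} ⊆ H_p`,
# `[G_j : N_j·G_j^p·⁅G_i, G_j⁆]` divides the order of the `Gal(K_{n+j}/K_{n+i})`-coinvariants of `Cl(K_{n+j})/p` (door L12 of the cell `bsd-potss`; proved)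

Topic `NumberTheory/IwasawaTheory` (namespace = path). THEOREM-ONLY file (no definition, no named fact, no `sorry`), written by the prover
seat `bsd-potss-k9-c4` g26 (cell `bsd-potss`; `μ`-roads of the record lane of stmt-BirchSwinnertonDyer-19197; closes nothing). Sibling of
`Fukuda1994Thm1RankLayer.exists_layer` (k8t-c4 g20: `[G_j : N_j] = p^{e_{n+j}}`, `[G_j : N_j·P_j] = p^{r_{n+j}}`) and of
`Fukuda1994Thm1RankLayerCentral.exists_layer_central` (conjA-anchor g21: centrality of `G_j/N_jP_j` under a class-group hypothesis), with the
SAME interface (the caller has built `T = K_{n+t}`, `B = K_n ⊆ T`, `H_p = HqF`, `A' = Gal(H_p/T)`, the inertia family `𝓘`).  OUTPUT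
(`exists_layer_coinvariant`, for `i ≤ j ≤ t`): subgroups `G_i = Gal(H_p/K_{n+i}) ⊇ G_j = Gal(H_p/K_{n+j}) ⊇ A'` of `G = Gal(H_p/K_n)` of indices
`p^i`, `p^j`, with **`[G_j : N_j·P_j·⁅G_i, G_j⁆] ∣ [Cl(K_{n+j}) : Cl^p·⟨σc·c⁻¹ : σ ∈ Gal(K_{n+j}/K_{n+i})⟩]`** — the right side is the order of
the `Gal(K_{n+j}/K_{n+i})`-COINVARIANTS of `Cl(K_{n+j})/p` (with `σ` ranging over the `K`-automorphisms of `K_{n+j}` fixing `K_{n+i}` pointwise).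
The class field theory is `UnramifiedElementaryCoinvariantModP.index_sup_pow_sup_comap_commutator_dvd` (this seat) over `k = K_{n+i}`,
`M = K_{n+j}`, `E = H_p`, transported into `G` along `Gal(H_p/K_{n+j}) ↪ Gal(H_p/K_{n+i}) ↪ Gal(H_p/K_n)`.

USE (door L12, `Fukuda1994Thm1RankPackageCoinvariant` / `ClassGroupPRankCoinvariantCriterion`): in the package `N_j·P_j·⁅G_i,G_j⁆ ∩ A' =
(φ^{p^i} − 1)A' + ν_j Y₀ + pA'` (`FukudaGroupCoinvariantLayer`), whose index in `A'` is `dim X̄/T^{p^i}X̄` at finite level — `≥ p^i` whenever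
`X̄ = X/pX` has a free `𝔽_p⟦T⟧`-summand; so a coinvariant quotient of `p`-rank `< p^i` at ONE pair of layers `(n+i, n+j)`, `i < j`, bounds every
`rank_p Cl(K_m)` and gives `μ = 0`.

References: [Fukuda1994] Thm. 1, p. 264; [Washington1997] §13.3 Lemmas 13.15, 13.18, Prop. 13.22/13.23; [Lang1990] Ch. 13 §4 (genus theory);
[NeukirchANT1999] Ch. IV §6, Ch. VI §7 Thm. (7.1); [Cox2013] §5.C Cor. 5.24, §8.A Thm. 8.10.
-/

noncomputable section

open scoped NumberField IsMulCommutative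
open NumberField IsDedekindDomain Field IntermediateField

namespace Literature.NumberTheory.IwasawaTheory

open Literature.NumberTheory.EllipticCurves Literature.NumberTheory.GaloisRepresentations
  Literature.NumberTheory.NumberFields

variable {K : Type} [Field K] [NumberField K] {p : ℕ} [hp : Fact p.Prime]

/-! ## §1 Two transports (proved apart, to keep the main elaboration inside the heartbeat budget) -/

section Transport

/-- **Class-group transport along a ring isomorphism `e : L ≃+* M`**: if every automorphism `σ` of `L` in the family `PL` becomes, after
transport by `e`, an `F₂`-automorphism of `M`, then the index of `Cl(M)^p·⟨σ'c·c⁻¹ : σ' ∈ Aut_{F₂}(M)⟩` divides the index of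
`Cl(L)^p·⟨σc·c⁻¹ : σ ∈ PL⟩` (`Cl(L) ≅ Cl(M)` along `e` maps the second subgroup into the first). [folklore] -/
private theorem index_dvd_index_of_ringEquiv {L M : Type*} [Field L] [NumberField L] [Field M] [NumberField M]
    {F₁ : Type*} [Field F₁] [Algebra F₁ L] {F₂ : Type*} [Field F₂] [Algebra F₂ M]
    (e : L ≃+* M) (p : ℕ) (PL : (L ≃ₐ[F₁] L) → Prop)
    (htr : ∀ σ : L ≃ₐ[F₁] L, PL σ → ∃ σ' : M ≃ₐ[F₂] M, ∀ y, σ' y = e (σ (e.symm y))) :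
    ((powMonoidHom p : ClassGroup (𝓞 M) →* ClassGroup (𝓞 M)).range ⊔
        Subgroup.closure {x | ∃ (σ' : M ≃ₐ[F₂] M) (c : ClassGroup (𝓞 M)),
          x = ClassGroup.mulEquiv (AmbiguousClass.intAut σ') c * c⁻¹}).index ∣
      ((powMonoidHom p : ClassGroup (𝓞 L) →* ClassGroup (𝓞 L)).range ⊔
        Subgroup.closure {x | ∃ (σ : L ≃ₐ[F₁] L) (_ : PL σ) (c : ClassGroup (𝓞 L)),
          x = ClassGroup.mulEquiv (AmbiguousClass.intAut σ) c * c⁻¹}).index := by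
  classical
  set E𝓞 : 𝓞 L ≃+* 𝓞 M := RingOfIntegers.mapRingEquiv e with hE𝓞
  set eCl : ClassGroup (𝓞 L) ≃* ClassGroup (𝓞 M) := ClassGroup.mulEquiv E𝓞 with heCl
  set SL : Subgroup (ClassGroup (𝓞 L)) := (powMonoidHom p : ClassGroup (𝓞 L) →* ClassGroup (𝓞 L)).range ⊔
    Subgroup.closure {x | ∃ (σ : L ≃ₐ[F₁] L) (_ : PL σ) (c : ClassGroup (𝓞 L)),
      x = ClassGroup.mulEquiv (AmbiguousClass.intAut σ) c * c⁻¹} with hSL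
  set SM : Subgroup (ClassGroup (𝓞 M)) := (powMonoidHom p : ClassGroup (𝓞 M) →* ClassGroup (𝓞 M)).range ⊔
    Subgroup.closure {x | ∃ (σ' : M ≃ₐ[F₂] M) (c : ClassGroup (𝓞 M)),
      x = ClassGroup.mulEquiv (AmbiguousClass.intAut σ') c * c⁻¹} with hSM
  have hEE : (ClassGroup.mulEquiv E𝓞).trans (ClassGroup.mulEquiv E𝓞.symm) = MulEquiv.refl _ := by
    rw [← Honda1971.classGroup_mulEquiv_trans, RingEquiv.self_trans_symm, Honda1971.classGroup_mulEquiv_refl]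
  have hmapSL : SL.map eCl.toMonoidHom ≤ SM := by
    rw [hSL, Subgroup.map_sup]
    refine sup_le ?_ ?_
    · rintro _ ⟨_, ⟨c, rfl⟩, rfl⟩
      exact Subgroup.mem_sup_left ⟨eCl c, by rw [powMonoidHom_apply, powMonoidHom_apply, MulEquiv.coe_toMonoidHom, map_pow]⟩
    · rw [Subgroup.map_le_iff_le_comap, Subgroup.closure_le]
      rintro _ ⟨σ, hσ, c, rfl⟩
      rw [SetLike.mem_coe, Subgroup.mem_comap]
      refine Subgroup.mem_sup_right (Subgroup.subset_closure ?_)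
      obtain ⟨σ', hσ'⟩ := htr σ hσ
      refine ⟨σ', eCl c, ?_⟩
      -- `intAut σ' = E ∘ intAut σ ∘ E⁻¹` on integers
      have hint : AmbiguousClass.intAut σ' = E𝓞.symm.trans ((AmbiguousClass.intAut σ).trans E𝓞) := by
        apply RingEquiv.ext
        intro y
        apply Subtype.ext
        change σ' (y : M) = e (σ (e.symm (y : M)))
        rw [hσ']
      have hc : ClassGroup.mulEquiv E𝓞.symm (eCl c) = c := by
        rw [heCl, ← MulEquiv.trans_apply, hEE, MulEquiv.refl_apply]
      rw [MulEquiv.coe_toMonoidHom, map_mul, map_inv, hint, Honda1971.classGroup_mulEquiv_trans, Honda1971.classGroup_mulEquiv_trans,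
        MulEquiv.trans_apply, MulEquiv.trans_apply, hc, heCl]
  have h1 : (SL.map eCl.toMonoidHom).index = SL.index := Subgroup.index_map_of_bijective eCl.bijective SL
  rw [← h1]
  exact Subgroup.index_dvd_of_le hmapSL

variable {k M E : Type} [Field k] [Field M] [NumberField M] [Field E] [NumberField E]
  [Algebra k M] [Algebra k E] [Algebra M E] [IsScalarTower k M E]
  [IsGalois k E] [IsGalois k M] [FiniteDimensional M E] [IsGalois M E] [IsUnramifiedAtInfinitePlaces M E]

/-- **The CFT export pushed into a bigger group**: with `G = Gal(E/M) →ρ Gal(E/k) →θ G₀` (`θ` injective; in the application `G₀ = Gal(E/B)` for a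
smaller base `B ⊆ k`), `[θρ(G) : θρ(N·G^p)·⁅θ(Gal(E/k)), θρ(G)⁆] ∣ [Cl(M) : Cl^p·⟨σc·c⁻¹ : σ ∈ Gal(M/k)⟩]`
(`UnramifiedElementaryCoinvariantModP.index_sup_pow_sup_comap_commutator_dvd`; `ρ(G)` is normalised by `Gal(E/k)` as `M/k` is normal).
[cite: NeukirchANT1999, Ch. IV §6 and Ch. VI §7 Thm. (7.1)] [cite: Washington1997, §13.3 Lemma 13.15 and Prop. 13.22] -/
private theorem relIndex_map_sup_commutator_dvd (p : ℕ) (N : Subgroup (E ≃ₐ[M] E))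
    (hcomm : ⁅(⊤ : Subgroup (E ≃ₐ[M] E)), ⊤⁆ ≤ N)
    (hIN : ∀ (Q : Ideal (𝓞 E)) [Q.IsMaximal], Q.inertia (E ≃ₐ[M] E) ≤ N)
    (ρ : (E ≃ₐ[M] E) →* (E ≃ₐ[k] E)) (hρ : ∀ a y, ρ a y = a y)
    {G₀ : Type*} [Group G₀] (θ : (E ≃ₐ[k] E) →* G₀) (hθ : Function.Injective θ) :
    (((N ⊔ Subgroup.closure (Set.range fun σ : E ≃ₐ[M] E => σ ^ p)).map (θ.comp ρ)) ⊔ ⁅θ.range, (θ.comp ρ).range⁆).relIndex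
        (θ.comp ρ).range ∣
      ((powMonoidHom p : ClassGroup (𝓞 M) →* ClassGroup (𝓞 M)).range ⊔
        Subgroup.closure {x | ∃ (σ : M ≃ₐ[k] M) (c : ClassGroup (𝓞 M)),
          x = ClassGroup.mulEquiv (AmbiguousClass.intAut σ) c * c⁻¹}).index := by
  classical
  have hcft := index_sup_pow_sup_comap_commutator_dvd k M E p N hcomm hIN ρ hρ
  set Pp : Subgroup (E ≃ₐ[M] E) := Subgroup.closure (Set.range fun σ : E ≃ₐ[M] E => σ ^ p) with hPp
  set D : Subgroup (E ≃ₐ[M] E) := (⁅(⊤ : Subgroup (E ≃ₐ[k] E)), ρ.range⁆).comap ρ with hD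
  -- `ρ(G)` is normalised by `Gal(E/k)` (`M/k` normal)
  have hcomm_le_range : ⁅(⊤ : Subgroup (E ≃ₐ[k] E)), ρ.range⁆ ≤ ρ.range := by
    rw [Subgroup.commutator_le]
    rintro τ - b ⟨a, rfl⟩
    have hτF : ∀ z : M, τ (algebraMap M E z) = algebraMap M E ((τ.restrictNormal M) z) := fun z =>
      (AlgEquiv.restrictNormal_commutes τ M z).symm
    have hτF_symm : ∀ z : M, τ.symm (algebraMap M E z) = algebraMap M E ((τ.restrictNormal M).symm z) := by
      intro z; apply τ.injective; rw [AlgEquiv.apply_symm_apply, hτF, AlgEquiv.apply_symm_apply]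
    let a' : E ≃ₐ[M] E :=
      AlgEquiv.ofRingEquiv (f := τ.symm.toRingEquiv.trans (a.toRingEquiv.trans τ.toRingEquiv)) fun z => by
        change τ (a (τ.symm (algebraMap M E z))) = algebraMap M E z
        rw [hτF_symm, AlgEquiv.commutes, hτF, AlgEquiv.apply_symm_apply]
    have hconj : τ * ρ a * τ⁻¹ = ρ a' := by
      apply AlgEquiv.ext; intro y
      rw [AlgEquiv.mul_apply, AlgEquiv.mul_apply, hρ, hρ]; rfl
    rw [commutatorElement_def, hconj, ← map_inv, ← map_mul]
    exact ⟨a' * a⁻¹, rfl⟩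
  have hDmap : D.map ρ = ⁅(⊤ : Subgroup (E ≃ₐ[k] E)), ρ.range⁆ := by
    rw [hD, Subgroup.map_comap_eq, inf_eq_right.mpr hcomm_le_range]
  have hinj : Function.Injective (θ.comp ρ) := by
    refine hθ.comp ?_
    intro a b hab
    apply AlgEquiv.ext
    intro y
    rw [← hρ a y, ← hρ b y, hab]
  have h1 : ((N ⊔ Pp) ⊔ D).map (θ.comp ρ) = ((N ⊔ Pp).map (θ.comp ρ)) ⊔ ⁅θ.range, (θ.comp ρ).range⁆ := by
    rw [Subgroup.map_sup, ← Subgroup.map_map D, hDmap, Subgroup.map_commutator, ← MonoidHom.range_eq_map, MonoidHom.range_comp]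
  rw [← h1, MonoidHom.range_eq_map (θ.comp ρ), Subgroup.relIndex_map_map_of_injective _ ⊤ hinj, Subgroup.relIndex_top_right]
  exact hcft

end Transport


/-- `restrict_algEquiv` does not move the underlying element (proved once, generically: the unfolding of `AlgEquiv.ofInjectiveField` behind it
is kernel-expensive in concrete towers). [folklore] -/
private theorem coe_restrict_algEquiv {K' L' : Type*} [Field K'] [Field L'] [Algebra K' L'] {F E : IntermediateField K' L'} (h : F ≤ E)
    (y : F) : ((IntermediateField.restrict_algEquiv h y : IntermediateField.restrict h) : E) = IntermediateField.inclusion h y :=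
  AlgEquiv.ofInjective_apply _ (IntermediateField.inclusion h).toRingHom.injective y

/-- `equivOfEq` does not move the underlying element. [folklore] -/
private theorem coe_equivOfEq {K' L' : Type*} [Field K'] [Field L'] [Algebra K' L'] {S S' : IntermediateField K' L'} (h : S = S')
    (x : S) : ((IntermediateField.equivOfEq h x : S') : L') = (x : L') := rfl

/-- `inclusion` does not move the underlying element. [folklore] -/
private theorem coe_inclusion {K' L' : Type*} [Field K'] [Field L'] [Algebra K' L'] {S S' : IntermediateField K' L'} (h : S ≤ S')
    (x : S) : ((IntermediateField.inclusion h x : S') : L') = (x : L') := rfl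

/-! ## §2 The class-group side: `Cl(K_{n+j})` versus the class group of the copy `F_j ⊆ K_{n+t}` of `K_{n+j}`, over the copy `F_i` of `K_{n+i}` -/

set_option maxHeartbeats 4000000 in
set_option synthInstance.maxHeartbeats 400000 in
/-- For the copies `F_i ⊆ F_j` of `K_{n+i} ⊆ K_{n+j}` inside `K_{n+t}` (intermediate fields over `B = K_n`, `F_j` an `F_i`-algebra through the
inclusion): the index of `Cl(F_j)^p·⟨σ'c·c⁻¹ : σ' ∈ Aut_{F_i}(F_j)⟩` divides the index of `Cl(K_{n+j})^p·⟨σc·c⁻¹ : σ ∈ Gal(K_{n+j}/K) fixing K_{n+i}⟩`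
(transport along the tautological `K_{n+j} ≅ F_j`; a `K`-automorphism of `K_{n+j}` fixing `K_{n+i}` becomes an `F_i`-automorphism of `F_j`). [folklore] -/
private theorem index_coinvariant_layer_dvd (κ : ZpExtension K p) (n t i j : ℕ) (hjt : j ≤ t)
    (Bi : IntermediateField K (κ.layer (n + t)))
    (Fie Fje : IntermediateField Bi (κ.layer (n + t))) [Algebra Fie Fje]
    (halg : ∀ z : Fie, ((algebraMap Fie Fje z : Fje) : κ.layer (n + t)) = (z : κ.layer (n + t)))
    (hFie : ∀ x : κ.layer (n + t), x ∈ Fie → ((x : κ.layer (n + t)) : AlgebraicClosure K) ∈ κ.layer (n + i))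
    (hFje : ∀ x : κ.layer (n + t), x ∈ Fje ↔ ((x : κ.layer (n + t)) : AlgebraicClosure K) ∈ κ.layer (n + j))
    [NumberField Fje] :
    ((powMonoidHom p : ClassGroup (𝓞 Fje) →* ClassGroup (𝓞 Fje)).range ⊔
        Subgroup.closure {x | ∃ (σ' : Fje ≃ₐ[Fie] Fje) (c : ClassGroup (𝓞 Fje)),
          x = ClassGroup.mulEquiv (AmbiguousClass.intAut σ') c * c⁻¹}).index ∣
      ((powMonoidHom p : ClassGroup (𝓞 (κ.layer (n + j))) →* ClassGroup (𝓞 (κ.layer (n + j)))).range ⊔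
        Subgroup.closure {x | ∃ (σ : (κ.layer (n + j)) ≃ₐ[K] (κ.layer (n + j)))
          (_ : ∀ y : κ.layer (n + j), ((y : κ.layer (n + j)) : AlgebraicClosure K) ∈ κ.layer (n + i) → σ y = y)
          (c : ClassGroup (𝓞 (κ.layer (n + j)))), x = ClassGroup.mulEquiv (AmbiguousClass.intAut σ) c * c⁻¹}).index := by
  classical
  haveI : FiniteDimensional K (κ.layer (n + j)) := κ.finiteDimensional_layer_holds (n + j)
  haveI : NumberField (κ.layer (n + j)) := NumberField.of_module_finite K _
  have hFjF : κ.layer (n + j) ≤ κ.layer (n + t) := κ.layer_mono (by omega)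
  -- ### a ring isomorphism `K_{n+j} ≅ F_j` preserving the underlying element of `\bar K` (kept opaque afterwards; the underlying-element
  -- fact is assembled from GENERIC coercion lemmas only — unfolding `restrict_algEquiv` at these concrete towers is kernel-expensive)
  obtain ⟨eL, hfwd⟩ : ∃ e : (κ.layer (n + j)) ≃+* Fje,
      ∀ y : κ.layer (n + j), (((e y : Fje) : κ.layer (n + t)) : AlgebraicClosure K) = (y : AlgebraicClosure K) := by
    obtain ⟨Fji, hFji⟩ : ∃ Fji : IntermediateField K (κ.layer (n + t)), Fji = IntermediateField.restrict hFjF := ⟨_, rfl⟩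
    let eFj : (κ.layer (n + j)) ≃ₐ[K] Fji :=
      (IntermediateField.restrict_algEquiv hFjF).trans (IntermediateField.equivOfEq hFji.symm)
    have hmemFje : ∀ x : (κ.layer (n + t)), x ∈ Fje ↔ x ∈ Fji := fun x => by
      rw [hFje, hFji, IntermediateField.mem_restrict]
    let eFje : Fji ≃+* Fje :=
      { toFun := fun x => ⟨x, (hmemFje _).mpr x.2⟩
        invFun := fun x => ⟨x, (hmemFje _).mp x.2⟩
        left_inv := fun _ => rfl
        right_inv := fun _ => rfl
        map_mul' := fun _ _ => rfl
        map_add' := fun _ _ => rfl }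
    refine ⟨eFj.toRingEquiv.trans eFje, fun y => ?_⟩
    have hA : (((eFj.toRingEquiv.trans eFje) y : Fje) : κ.layer (n + t)) = ((eFj y : Fji) : κ.layer (n + t)) := rfl
    have hC : ((eFj y : Fji) : κ.layer (n + t)) =
        ((IntermediateField.restrict_algEquiv hFjF y : IntermediateField.restrict hFjF) : κ.layer (n + t)) := by
      show ((((IntermediateField.restrict_algEquiv hFjF).trans (IntermediateField.equivOfEq hFji.symm)) y : Fji) : κ.layer (n + t)) = _
      rw [AlgEquiv.trans_apply, coe_equivOfEq]
    rw [hA, hC, coe_restrict_algEquiv hFjF y, coe_inclusion]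
  have hcoe_symm : ∀ w : Fje, ((eL.symm w : κ.layer (n + j)) : AlgebraicClosure K) = ((w : κ.layer (n + t)) : AlgebraicClosure K) := by
    intro w
    have h0 := hfwd (eL.symm w)
    rw [eL.apply_symm_apply] at h0
    exact h0.symm
  have htr : ∀ σ : (κ.layer (n + j)) ≃ₐ[K] (κ.layer (n + j)),
      (∀ y : κ.layer (n + j), ((y : κ.layer (n + j)) : AlgebraicClosure K) ∈ κ.layer (n + i) → σ y = y) →
      ∃ σ' : Fje ≃ₐ[Fie] Fje, ∀ y, σ' y = eL (σ (eL.symm y)) := by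
    intro σ hσfix
    have hfix : ∀ z : Fie, σ (eL.symm (algebraMap Fie Fje z)) = eL.symm (algebraMap Fie Fje z) := by
      intro z
      apply hσfix
      rw [hcoe_symm, halg]
      exact hFie _ z.2
    exact ⟨AlgEquiv.ofRingEquiv (f := eL.symm.trans (σ.toRingEquiv.trans eL)) fun z => by
        change eL (σ (eL.symm (algebraMap Fie Fje z))) = algebraMap Fie Fje z
        rw [hfix z, RingEquiv.apply_symm_apply], fun _ => rfl⟩
  exact index_dvd_index_of_ringEquiv (F₂ := Fie) eL p
    (fun σ => ∀ y : κ.layer (n + j), ((y : κ.layer (n + j)) : AlgebraicClosure K) ∈ κ.layer (n + i) → σ y = y) htr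

/-! ## §3 The layers and the export -/

set_option maxHeartbeats 40000000 in
set_option synthInstance.maxHeartbeats 400000 in
/-- **The layers `G_i = Gal(H_p/K_{n+i}) ⊇ G_j = Gal(H_p/K_{n+j})` of `Gal(H_p/K_n)` and the COINVARIANT export**
(interface of `Fukuda1994Thm1RankLayer.exists_layer`; `v` is `ord_p h(K_{n+t})`, only `[H_p : K_n] = p^t·p^v` is used): for `i ≤ j ≤ t` there are
`G_i, G_j ≤ Gal(H_p/K_n)` with `A' ≤ G_j ≤ G_i`, `[G : G_i] = p^i`, `[G : G_j] = p^j` and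
`[G_j : (G_j'·⟨I ∩ G_j⟩)·⟨x^p : x ∈ G_j⟩·⁅G_i, G_j⁆] ∣ [Cl(K_{n+j}) : Cl^p·⟨σc·c⁻¹ : σ ∈ Gal(K_{n+j}/K) fixing K_{n+i}⟩]`.
[cite: Washington1997, §13.3 Lemmas 13.15 and 13.18, Prop. 13.22] [cite: Fukuda1994, Thm. 1 (2), p. 264 (proof)]
[cite: NeukirchANT1999, Ch. IV §6 and Ch. VI §7 Thm. (7.1)] [cite: Lang1990, Ch. 13 §4] -/
theorem exists_layer_coinvariant (κ : ZpExtension K p) (n t i j : ℕ) (hij : i ≤ j) (hj : j ≤ t)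
    [FiniteDimensional K (κ.layer (n + t))] [IsGalois K (κ.layer (n + t))] [NumberField (κ.layer (n + t))]
    (Bi : IntermediateField K (κ.layer (n + t))) (hBi : Bi = IntermediateField.restrict (κ.layer_mono (Nat.le_add_right n t)))
    [FiniteDimensional K Bi] [IsGalois K Bi] [NumberField Bi] [IsGalois Bi (κ.layer (n + t))]
    (hdegKB : Module.finrank K Bi = p ^ n)
    [IsGalois Bi (hilbertClassField (κ.layer (n + t)))] [FiniteDimensional Bi (hilbertClassField (κ.layer (n + t)))]
    (HqF : IntermediateField (κ.layer (n + t)) (hilbertClassField (κ.layer (n + t))))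
    [IsGalois Bi HqF] [FiniteDimensional Bi HqF] [NumberField HqF] [IsScalarTower Bi HqF (hilbertClassField (κ.layer (n + t)))]
    [IsGalois (κ.layer (n + t)) HqF] [IsUnramifiedAtInfinitePlaces Bi HqF] [IsScalarTower Bi (κ.layer (n + t)) HqF]
    (v : ℕ) (hdegHp : Module.finrank Bi HqF = p ^ t * p ^ v)
    (A' : Subgroup (HqF ≃ₐ[Bi] HqF))
    (hmemA' : ∀ g : HqF ≃ₐ[Bi] HqF, g ∈ A' ↔ ∀ x : (κ.layer (n + t)), g (algebraMap (κ.layer (n + t)) HqF x) = algebraMap (κ.layer (n + t)) HqF x)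
    (𝓘 : Set (Subgroup (HqF ≃ₐ[Bi] HqF)))
    (h𝓘def : 𝓘 = Set.range (fun Q : MaximalSpectrum (𝓞 HqF) => Q.asIdeal.inertia (HqF ≃ₐ[Bi] HqF))) :
    ∃ Gi Gj : Subgroup (HqF ≃ₐ[Bi] HqF), A' ≤ Gj ∧ Gj ≤ Gi ∧ Gi.index = p ^ i ∧ Gj.index = p ^ j ∧
      (((⁅Gj, Gj⁆ ⊔ ⨆ I ∈ 𝓘, I ⊓ Gj) ⊔ Subgroup.closure ((fun x : HqF ≃ₐ[Bi] HqF => x ^ p) '' (Gj : Set (HqF ≃ₐ[Bi] HqF)))) ⊔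
          ⁅Gi, Gj⁆).relIndex Gj ∣
        ((powMonoidHom p : ClassGroup (𝓞 (κ.layer (n + j))) →* ClassGroup (𝓞 (κ.layer (n + j)))).range ⊔
          Subgroup.closure {x | ∃ (σ : (κ.layer (n + j)) ≃ₐ[K] (κ.layer (n + j)))
            (_ : ∀ y : κ.layer (n + j), ((y : κ.layer (n + j)) : AlgebraicClosure K) ∈ κ.layer (n + i) → σ y = y)
            (c : ClassGroup (𝓞 (κ.layer (n + j)))), x = ClassGroup.mulEquiv (AmbiguousClass.intAut σ) c * c⁻¹}).index := by
  classical
  have hp0 : 0 < p := hp.out.pos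
  haveI : FiniteDimensional K (κ.layer (n + j)) := κ.finiteDimensional_layer_holds (n + j)
  haveI : IsGalois K (κ.layer (n + j)) := κ.isGalois_layer_holds (n + j)
  haveI : NumberField (κ.layer (n + j)) := NumberField.of_module_finite K _
  haveI : FiniteDimensional K (κ.layer (n + i)) := κ.finiteDimensional_layer_holds (n + i)
  haveI : IsGalois K (κ.layer (n + i)) := κ.isGalois_layer_holds (n + i)
  have hBFi : κ.layer n ≤ κ.layer (n + i) := κ.layer_mono (Nat.le_add_right n i)
  have hBFj : κ.layer n ≤ κ.layer (n + j) := κ.layer_mono (Nat.le_add_right n j)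
  have hFiFj : κ.layer (n + i) ≤ κ.layer (n + j) := κ.layer_mono (by omega)
  have hFiF : κ.layer (n + i) ≤ κ.layer (n + t) := κ.layer_mono (by omega)
  have hFjF : κ.layer (n + j) ≤ κ.layer (n + t) := κ.layer_mono (by omega)
  -- ### the intermediate layers `F_i ⊆ F_j` as intermediate fields of `T/B`
  obtain ⟨Fii, hFii⟩ : ∃ Fii : IntermediateField K (κ.layer (n + t)), Fii = IntermediateField.restrict hFiF := ⟨_, rfl⟩
  obtain ⟨Fji, hFji⟩ : ∃ Fji : IntermediateField K (κ.layer (n + t)), Fji = IntermediateField.restrict hFjF := ⟨_, rfl⟩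
  have hBiFii : Bi ≤ Fii := by
    intro x hx
    rw [hBi, IntermediateField.mem_restrict] at hx
    rw [hFii, IntermediateField.mem_restrict]
    exact hBFi hx
  have hBiFji : Bi ≤ Fji := by
    intro x hx
    rw [hBi, IntermediateField.mem_restrict] at hx
    rw [hFji, IntermediateField.mem_restrict]
    exact hBFj hx
  let eFi : (κ.layer (n + i)) ≃ₐ[K] Fii :=
    (IntermediateField.restrict_algEquiv hFiF).trans (IntermediateField.equivOfEq hFii.symm)
  let eFj : (κ.layer (n + j)) ≃ₐ[K] Fji :=
    (IntermediateField.restrict_algEquiv hFjF).trans (IntermediateField.equivOfEq hFji.symm)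
  obtain ⟨Fie, hFie⟩ : ∃ Fie : IntermediateField Bi (κ.layer (n + t)), Fie = IntermediateField.extendScalars hBiFii :=
    ⟨_, rfl⟩
  obtain ⟨Fje, hFje⟩ : ∃ Fje : IntermediateField Bi (κ.layer (n + t)), Fje = IntermediateField.extendScalars hBiFji :=
    ⟨_, rfl⟩
  have hmemFie : ∀ x : (κ.layer (n + t)), x ∈ Fie ↔ x ∈ Fii := fun x => by
    rw [hFie, IntermediateField.mem_extendScalars]
  have hmemFje : ∀ x : (κ.layer (n + t)), x ∈ Fje ↔ x ∈ Fji := fun x => by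
    rw [hFje, IntermediateField.mem_extendScalars]
  have hFieFje : Fie ≤ Fje := by
    intro x hx
    rw [hmemFie, hFii, IntermediateField.mem_restrict] at hx
    rw [hmemFje, hFji, IntermediateField.mem_restrict]
    exact hFiFj hx
  haveI : FiniteDimensional K Fii := LinearEquiv.finiteDimensional eFi.toLinearEquiv
  haveI : IsGalois K Fii := IsGalois.of_algEquiv eFi
  haveI : FiniteDimensional K Fji := LinearEquiv.finiteDimensional eFj.toLinearEquiv
  haveI : IsGalois K Fji := IsGalois.of_algEquiv eFj
  haveI hFiefd : FiniteDimensional K Fie := by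
    have : FiniteDimensional K (Fie.restrictScalars K) := by rw [hFie, IntermediateField.extendScalars_restrictScalars]; infer_instance
    exact this
  haveI : IsGalois K Fie := by
    have : IsGalois K (Fie.restrictScalars K) := by rw [hFie, IntermediateField.extendScalars_restrictScalars]; infer_instance
    exact this
  haveI : NumberField Fie := NumberField.of_module_finite K _
  haveI : IsGalois Bi Fie := IsGalois.tower_top_of_isGalois K Bi Fie
  haveI : IsScalarTower K Fie (κ.layer (n + t)) := IsScalarTower.of_algebraMap_eq fun _ => rfl
  haveI hFjefd : FiniteDimensional K Fje := by
    have : FiniteDimensional K (Fje.restrictScalars K) := by rw [hFje, IntermediateField.extendScalars_restrictScalars]; infer_instance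
    exact this
  haveI : IsGalois K Fje := by
    have : IsGalois K (Fje.restrictScalars K) := by rw [hFje, IntermediateField.extendScalars_restrictScalars]; infer_instance
    exact this
  haveI : NumberField Fje := NumberField.of_module_finite K _
  haveI : IsGalois Bi Fje := IsGalois.tower_top_of_isGalois K Bi Fje
  haveI : IsScalarTower K Fje (κ.layer (n + t)) := IsScalarTower.of_algebraMap_eq fun _ => rfl
  -- `F_j` as an `F_i`-algebra through the inclusion
  letI : Algebra Fie Fje := (IntermediateField.inclusion hFieFje).toRingHom.toAlgebra
  have halg : ∀ z : Fie, ((algebraMap Fie Fje z : Fje) : κ.layer (n + t)) = (z : κ.layer (n + t)) := fun _ => rfl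
  haveI : IsScalarTower Bi Fie Fje := IsScalarTower.of_algebraMap_eq fun _ => rfl
  haveI : IsScalarTower K Fie Fje := IsScalarTower.of_algebraMap_eq fun _ => rfl
  haveI : IsGalois Fie Fje := IsGalois.tower_top_of_isGalois K Fie Fje
  -- scalar towers for `HqF` over `F_i` and `F_j`
  haveI : IsScalarTower Bi Fie HqF := IsScalarTower.of_algebraMap_eq fun _ => rfl
  haveI : IsScalarTower K Fie HqF := IsScalarTower.of_algebraMap_eq fun _ => rfl
  haveI : IsScalarTower Bi Fje HqF := IsScalarTower.of_algebraMap_eq fun _ => rfl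
  haveI : IsScalarTower K Fje HqF := IsScalarTower.of_algebraMap_eq fun _ => rfl
  haveI : IsScalarTower Fie Fje HqF := IsScalarTower.of_algebraMap_eq fun _ => rfl
  haveI : IsGalois Fie HqF := IsGalois.tower_top_of_isGalois Bi Fie HqF
  haveI : IsGalois Fje HqF := IsGalois.tower_top_of_isGalois Bi Fje HqF
  haveI : FiniteDimensional Fie HqF := Module.Finite.of_restrictScalars_finite Bi Fie HqF
  haveI : FiniteDimensional Fje HqF := Module.Finite.of_restrictScalars_finite Bi Fje HqF
  haveI : IsUnramifiedAtInfinitePlaces Fje HqF := IsUnramifiedAtInfinitePlaces.top (k := Bi) (K := Fje) (F := HqF)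
  haveI : Module.Free Fie HqF := Module.Free.of_divisionRing Fie HqF
  haveI : Module.Free Fje HqF := Module.Free.of_divisionRing Fje HqF
  haveI : Module.Free Bi Fie := Module.Free.of_divisionRing Bi Fie
  haveI : Module.Free Bi Fje := Module.Free.of_divisionRing Bi Fje
  haveI : Module.Free Bi HqF := Module.Free.of_divisionRing Bi HqF
  -- degrees
  have hdegBFi : Module.finrank Bi Fie = p ^ i := by
    have h := Module.finrank_mul_finrank K Bi Fie
    have h2 : Module.finrank K Fie = p ^ (n + i) := by
      have : Module.finrank K (Fie.restrictScalars K) = Module.finrank K Fii := by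
        rw [hFie, IntermediateField.extendScalars_restrictScalars]
      rw [← κ.finrank_layer_holds (n + i), eFi.toLinearEquiv.finrank_eq, ← this]; rfl
    rw [hdegKB, h2, pow_add] at h
    exact Nat.eq_of_mul_eq_mul_left (pow_pos hp0 n) h
  have hdegBFj : Module.finrank Bi Fje = p ^ j := by
    have h := Module.finrank_mul_finrank K Bi Fje
    have h2 : Module.finrank K Fje = p ^ (n + j) := by
      have : Module.finrank K (Fje.restrictScalars K) = Module.finrank K Fji := by
        rw [hFje, IntermediateField.extendScalars_restrictScalars]
      rw [← κ.finrank_layer_holds (n + j), eFj.toLinearEquiv.finrank_eq, ← this]; rfl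
    rw [hdegKB, h2, pow_add] at h
    exact Nat.eq_of_mul_eq_mul_left (pow_pos hp0 n) h
  have hGpcard : Nat.card (HqF ≃ₐ[Bi] HqF) = p ^ t * p ^ v := by rw [IsGalois.card_aut_eq_finrank, hdegHp]
  -- ### the Galois groups `G_i`, `G_j` as images of restriction of scalars
  let ρi : (HqF ≃ₐ[Fie] HqF) →* (HqF ≃ₐ[Bi] HqF) :=
    { toFun := fun σ => σ.restrictScalars Bi
      map_one' := rfl
      map_mul' := fun _ _ => rfl }
  let ρj : (HqF ≃ₐ[Fje] HqF) →* (HqF ≃ₐ[Bi] HqF) :=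
    { toFun := fun σ => σ.restrictScalars Bi
      map_one' := rfl
      map_mul' := fun _ _ => rfl }
  let ρji : (HqF ≃ₐ[Fje] HqF) →* (HqF ≃ₐ[Fie] HqF) :=
    { toFun := fun σ => σ.restrictScalars Fie
      map_one' := rfl
      map_mul' := fun _ _ => rfl }
  have hρi_inj : Function.Injective ρi := fun σ τ h => AlgEquiv.restrictScalars_injective Bi h
  have hρj_inj : Function.Injective ρj := fun σ τ h => AlgEquiv.restrictScalars_injective Bi h
  have hρi_apply : ∀ a y, ρi a y = a y := fun _ _ => rfl
  have hρji_apply : ∀ a y, ρji a y = a y := fun _ _ => rfl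
  have hρcomp : ρi.comp ρji = ρj := MonoidHom.ext fun _ => AlgEquiv.ext fun _ => rfl
  obtain ⟨Gi, hGi⟩ : ∃ Gi : Subgroup (HqF ≃ₐ[Bi] HqF), Gi = ρi.range := ⟨_, rfl⟩
  obtain ⟨Gj, hGj⟩ : ∃ Gj : Subgroup (HqF ≃ₐ[Bi] HqF), Gj = ρj.range := ⟨_, rfl⟩
  have hGjGi : Gj ≤ Gi := by
    rw [hGj, hGi, ← hρcomp]
    rintro _ ⟨σ, rfl⟩
    exact ⟨ρji σ, rfl⟩
  have hGiindex : Gi.index = p ^ i := by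
    have hcard' : Nat.card (HqF ≃ₐ[Fie] HqF) * p ^ i = p ^ t * p ^ v := by
      have h1 := Module.finrank_mul_finrank Bi Fie HqF
      rw [hdegBFi, hdegHp] at h1
      rw [IsGalois.card_aut_eq_finrank, mul_comm]
      exact h1
    rw [hGi]
    have h1 := ρi.range.index_mul_card
    rw [← Nat.card_congr (MonoidHom.ofInjective hρi_inj).toEquiv, hGpcard, ← hcard', mul_comm] at h1
    exact Nat.eq_of_mul_eq_mul_left Nat.card_pos h1
  have hGjindex : Gj.index = p ^ j := by
    have hcard' : Nat.card (HqF ≃ₐ[Fje] HqF) * p ^ j = p ^ t * p ^ v := by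
      have h1 := Module.finrank_mul_finrank Bi Fje HqF
      rw [hdegBFj, hdegHp] at h1
      rw [IsGalois.card_aut_eq_finrank, mul_comm]
      exact h1
    rw [hGj]
    have h1 := ρj.range.index_mul_card
    rw [← Nat.card_congr (MonoidHom.ofInjective hρj_inj).toEquiv, hGpcard, ← hcard', mul_comm] at h1
    exact Nat.eq_of_mul_eq_mul_left Nat.card_pos h1
  have hA'Gj : A' ≤ Gj := by
    intro x hx
    rw [hGj]
    exact ⟨{ x with commutes' := fun y => (hmemA' x).mp hx (y : κ.layer (n + t)) }, AlgEquiv.ext fun _ => rfl⟩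
  -- ### class field theory over `F_i ⊆ F_j ⊆ H_p` (this seat's CFT brick, pushed into `Gal(H_p/B)` along `ρi`)
  obtain ⟨Nj, hNj⟩ : ∃ Nj : Subgroup (HqF ≃ₐ[Fje] HqF), Nj =
      ⁅(⊤ : Subgroup (HqF ≃ₐ[Fje] HqF)), ⊤⁆ ⊔ ⨆ (Q : MaximalSpectrum (𝓞 HqF)), Q.asIdeal.inertia (HqF ≃ₐ[Fje] HqF) :=
    ⟨_, rfl⟩
  have hIN : ∀ (Q : Ideal (𝓞 HqF)) [Q.IsMaximal], Q.inertia (HqF ≃ₐ[Fje] HqF) ≤ Nj := fun Q _ => by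
    rw [hNj]
    exact le_sup_of_le_right
      (le_iSup (fun Q : MaximalSpectrum (𝓞 HqF) => Q.asIdeal.inertia (HqF ≃ₐ[Fje] HqF)) ⟨Q, ‹_›⟩)
  have hcft := relIndex_map_sup_commutator_dvd (k := Fie) (M := Fje) (E := HqF) p Nj (by rw [hNj]; exact le_sup_left) hIN
    ρji hρji_apply ρi hρi_inj
  rw [hρcomp, ← hGi, ← hGj] at hcft
  -- `N_j ↦ G_j'·⟨I ∩ G_j⟩`, `P_j ↦ ⟨x^p : x ∈ G_j⟩`
  have hmapI : ∀ Q : MaximalSpectrum (𝓞 HqF),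
      (Q.asIdeal.inertia (HqF ≃ₐ[Fje] HqF)).map ρj = Q.asIdeal.inertia (HqF ≃ₐ[Bi] HqF) ⊓ ρj.range := by
    intro Q
    ext x
    constructor
    · rintro ⟨σ, hσI, rfl⟩
      exact ⟨fun y => hσI y, ⟨σ, rfl⟩⟩
    · rintro ⟨hgI, ⟨σ, rfl⟩⟩
      exact ⟨σ, fun y => hgI y, rfl⟩
  have hmapN : Nj.map ρj = ⁅Gj, Gj⁆ ⊔ ⨆ I ∈ 𝓘, I ⊓ Gj := by
    rw [hGj, hNj, Subgroup.map_sup, Subgroup.map_commutator, ← MonoidHom.range_eq_map, Subgroup.map_iSup, h𝓘def,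
      iSup_range]
    simp_rw [hmapI]
  have hmapP : (Subgroup.closure (Set.range fun σ : HqF ≃ₐ[Fje] HqF => σ ^ p)).map ρj =
      Subgroup.closure ((fun x : HqF ≃ₐ[Bi] HqF => x ^ p) '' (Gj : Set (HqF ≃ₐ[Bi] HqF))) := by
    rw [MonoidHom.map_closure]
    congr 1
    ext x
    constructor
    · rintro ⟨_, ⟨σ, rfl⟩, rfl⟩
      exact ⟨ρj σ, by rw [hGj]; exact ⟨σ, rfl⟩, by rw [map_pow]⟩
    · rintro ⟨y, hy, rfl⟩
      rw [hGj] at hy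
      obtain ⟨σ, rfl⟩ := hy
      exact ⟨σ ^ p, ⟨σ, rfl⟩, by rw [map_pow]⟩
  rw [Subgroup.map_sup, hmapN, hmapP] at hcft
  -- ### the class-group side (§2)
  have hFie' : ∀ x : κ.layer (n + t), x ∈ Fie → ((x : κ.layer (n + t)) : AlgebraicClosure K) ∈ κ.layer (n + i) := by
    intro x hx
    have h1 : x ∈ Fii := (hmemFie x).mp hx
    rw [hFii, IntermediateField.mem_restrict] at h1
    exact h1
  have hFje' : ∀ x : κ.layer (n + t), x ∈ Fje ↔ ((x : κ.layer (n + t)) : AlgebraicClosure K) ∈ κ.layer (n + j) := by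
    intro x
    rw [hmemFje, hFji, IntermediateField.mem_restrict]
  have hindexS := index_coinvariant_layer_dvd κ n t i j hj Bi Fie Fje halg hFie' hFje'
  -- ### assemble
  exact ⟨Gi, Gj, hA'Gj, hGjGi, hGiindex, hGjindex, hcft.trans hindexS⟩

end Literature.NumberTheory.IwasawaTheory

end
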